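import Mathlib
import HarnessLib
import Summits.ValiantsHypothesis.ValiantsHypothesis.Theorems.LacunarySymmetroidMatrixDescartesOsculationLawPeelMaximalBranchLeft

/-!
# ValiantsHypothesis / LacunarySymmetroid — crux `MatrixDescartes` (stmt-ValiantsHypothesis-18050, V1),
# line `Cruxes/MatrixDescartes/Lines/osculation_law.lean` («osculation-law»), stub `stub_peel` (ALL ranks):
# THE MAXIMAL BRANCH THROUGH A CURVE POINT, TWO-SIDED (rank-free; piece (α)/(γ1) of NOTE-p7g12-peel-general-r-sizing.md)

Glueing `exists_left_maximal_branch` and `exists_right_maximal_branch` at `t₀`: through every curve point `(t₀, b₀)` of the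
open quadrant (hyperbolic vertical family, finite osculation set, GP) passes ONE continuous positive solution `β` on an open
interval `(α, ω) ∋ t₀` inside `t > 0`, each of whose two ends is classified: LEFT end `α = 0`-type (alive on every `(T, t₀]`,
`T > 0`) or `0 < α` with `β → 0` / `β → +∞` at `α⁺`; RIGHT end `ω = ∞`-type (alive on every `[t₀, T)`) or `β → 0` / `β → +∞`
at `ω⁻`.  The statement is phrased with the two one-sided theorems' alternatives and a single function `β`.

* **`exists_maximal_branch`**.

Honest framing: a rank-free LEMMA toward the OPEN stub `stub_peel` (all `r`); nothing of the summit is proved; `VP ≠ VNP` is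
NOT proved.  No definitions, no named facts.
-/

-- `Summit.ValiantsHypothesis.ValiantsHypothesis.…` is the tree's mandated single-conjunct layout (Sub = Summit).
set_option linter.dupNamespace false

noncomputable section

namespace Summit.ValiantsHypothesis.ValiantsHypothesis.Theorems.LacunarySymmetroidMatrixDescartes

open Polynomial Set Filter
open MvPolynomial (pderiv)
open scoped BigOperators Topology

namespace OsculationPeel

/-- **The maximal branch through a curve point, two-sided.** [folklore] -/
theorem exists_maximal_branch (Φ : MvPolynomial (Fin 2) ℝ) (P : ℝ → ℝ[X])
    (hP : ∀ t b, (P t).eval b = MvPolynomial.eval ![t, b] Φ) (hsplit : ∀ t, 0 < t → (P t).Splits)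
    (hfin : {p : Fin 2 → ℝ | 0 < p 0 ∧ 0 < p 1 ∧ MvPolynomial.eval p Φ = 0 ∧
      MvPolynomial.eval p
        (MvPolynomial.X 0 * MvPolynomial.pderiv 0 (MvPolynomial.X 0 * MvPolynomial.pderiv 0 Φ)
            * (MvPolynomial.X 1 * MvPolynomial.pderiv 1 Φ) ^ 2
          - 2 * (MvPolynomial.X 0 * MvPolynomial.pderiv 0 (MvPolynomial.X 1 * MvPolynomial.pderiv 1 Φ))
            * (MvPolynomial.X 0 * MvPolynomial.pderiv 0 Φ) * (MvPolynomial.X 1 * MvPolynomial.pderiv 1 Φ)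
          + MvPolynomial.X 1 * MvPolynomial.pderiv 1 (MvPolynomial.X 1 * MvPolynomial.pderiv 1 Φ)
            * (MvPolynomial.X 0 * MvPolynomial.pderiv 0 Φ) ^ 2) = 0}.Finite)
    (hgp : ∀ p ∈ {p : Fin 2 → ℝ | 0 < p 0 ∧ 0 < p 1 ∧ MvPolynomial.eval p Φ = 0 ∧
      MvPolynomial.eval p
        (MvPolynomial.X 0 * MvPolynomial.pderiv 0 (MvPolynomial.X 0 * MvPolynomial.pderiv 0 Φ)
            * (MvPolynomial.X 1 * MvPolynomial.pderiv 1 Φ) ^ 2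
          - 2 * (MvPolynomial.X 0 * MvPolynomial.pderiv 0 (MvPolynomial.X 1 * MvPolynomial.pderiv 1 Φ))
            * (MvPolynomial.X 0 * MvPolynomial.pderiv 0 Φ) * (MvPolynomial.X 1 * MvPolynomial.pderiv 1 Φ)
          + MvPolynomial.X 1 * MvPolynomial.pderiv 1 (MvPolynomial.X 1 * MvPolynomial.pderiv 1 Φ)
            * (MvPolynomial.X 0 * MvPolynomial.pderiv 0 Φ) ^ 2) = 0},
        MvPolynomial.eval p (MvPolynomial.pderiv 1 Φ) ≠ 0)
    {t₀ b₀ : ℝ} (ht₀ : 0 < t₀) (hb₀ : 0 < b₀) (hΦ : MvPolynomial.eval ![t₀, b₀] Φ = 0) :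
    ∃ β : ℝ → ℝ, β t₀ = b₀ ∧ ContinuousAt β t₀ ∧
      ((∀ T, 0 < T → T < t₀ → ContinuousOn β (Ioc T t₀) ∧ ∀ t ∈ Ioc T t₀, 0 < β t ∧ MvPolynomial.eval ![t, β t] Φ = 0) ∨
       ∃ α, 0 < α ∧ α < t₀ ∧ ContinuousOn β (Ioc α t₀) ∧ (∀ t ∈ Ioc α t₀, 0 < β t ∧ MvPolynomial.eval ![t, β t] Φ = 0) ∧
         (Tendsto β (𝓝[>] α) (𝓝 0) ∨ Tendsto β (𝓝[>] α) atTop)) ∧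
      ((∀ T, t₀ < T → ContinuousOn β (Ico t₀ T) ∧ ∀ t ∈ Ico t₀ T, 0 < β t ∧ MvPolynomial.eval ![t, β t] Φ = 0) ∨
       ∃ ω, t₀ < ω ∧ ContinuousOn β (Ico t₀ ω) ∧ (∀ t ∈ Ico t₀ ω, 0 < β t ∧ MvPolynomial.eval ![t, β t] Φ = 0) ∧
         (Tendsto β (𝓝[<] ω) (𝓝 0) ∨ Tendsto β (𝓝[<] ω) atTop)) := by
  obtain ⟨βL, hL0, hL⟩ := exists_left_maximal_branch Φ P hP hsplit hfin hgp ht₀ hb₀ hΦ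
  obtain ⟨βR, hR0, hR⟩ := exists_right_maximal_branch Φ P hP hsplit hfin hgp ht₀ hb₀ hΦ
  -- glue: `β = βL` on `t ≤ t₀`, `βR` on `t > t₀`
  let β : ℝ → ℝ := fun t => if t ≤ t₀ then βL t else βR t
  have hβL : ∀ t, t ≤ t₀ → β t = βL t := fun t ht => by simp only [β, if_pos ht]
  have hβR : ∀ t, t₀ ≤ t → β t = βR t := fun t ht => by
    rcases ht.eq_or_lt with rfl | hlt
    · simp only [β, if_pos le_rfl, hL0, hR0]
    · simp only [β, if_neg (not_le.2 hlt)]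
  have hβ0 : β t₀ = b₀ := by rw [hβL t₀ le_rfl, hL0]
  -- one-sided continuity data at `t₀`
  have hLc : ∃ T, T < t₀ ∧ ContinuousOn βL (Ioc T t₀) := by
    rcases hL with h | ⟨α, hα, hαt, hc, -, -⟩
    · exact ⟨t₀ / 2, by linarith, (h (t₀ / 2) (by linarith) (by linarith)).1⟩
    · exact ⟨α, hαt, hc⟩
  have hRc : ∃ T, t₀ < T ∧ ContinuousOn βR (Ico t₀ T) := by
    rcases hR with h | ⟨ω, hω, hc, -, -⟩
    · exact ⟨t₀ + 1, by linarith, (h (t₀ + 1) (by linarith)).1⟩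
    · exact ⟨ω, hω, hc⟩
  have hcont : ContinuousAt β t₀ := by
    obtain ⟨T₁, hT₁, hcL⟩ := hLc
    obtain ⟨T₂, hT₂, hcR⟩ := hRc
    have h1 : ContinuousWithinAt β (Iic t₀) t₀ := by
      have h := (hcL t₀ ⟨hT₁, le_rfl⟩).mono_of_mem_nhdsWithin (s := Iic t₀)
        (mem_of_superset (inter_mem_nhdsWithin (Iic t₀) (Ioi_mem_nhds hT₁)) fun u hu => ⟨hu.2, hu.1⟩)
      exact h.congr (fun u hu => hβL u hu) (hβL t₀ le_rfl)
    have h2 : ContinuousWithinAt β (Ici t₀) t₀ := by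
      have h := (hcR t₀ ⟨le_rfl, hT₂⟩).mono_of_mem_nhdsWithin (s := Ici t₀)
        (mem_of_superset (inter_mem_nhdsWithin (Ici t₀) (Iio_mem_nhds hT₂)) fun u hu => ⟨hu.1, hu.2⟩)
      exact h.congr (fun u hu => hβR u hu) (hβR t₀ le_rfl)
    exact continuousAt_iff_continuous_left_right.2 ⟨h1, h2⟩
  refine ⟨β, hβ0, hcont, ?_, ?_⟩
  · -- left alternatives transfer from `βL` (they only look at `t ≤ t₀`)
    have hE : ∀ T, EqOn β βL (Ioc T t₀) := fun T t ht => hβL t ht.2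
    rcases hL with h | ⟨α, hα, hαt, hc, hs, hend⟩
    · left
      intro T hT hTt
      obtain ⟨hc, hs⟩ := h T hT hTt
      exact ⟨hc.congr (hE T), fun t ht => by rw [hE T ht]; exact hs t ht⟩
    · right
      refine ⟨α, hα, hαt, hc.congr (hE α), fun t ht => by rw [hE α ht]; exact hs t ht, ?_⟩
      have hev : β =ᶠ[𝓝[>] α] βL :=
        mem_of_superset (Ioo_mem_nhdsGT hαt) fun u hu => hβL u hu.2.le
      rcases hend with h0 | htop
      · exact Or.inl (h0.congr' (hev.mono fun u hu => hu.symm))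
      · exact Or.inr (htop.congr' (hev.mono fun u hu => hu.symm))
  · -- right alternatives transfer from `βR`
    have hE : ∀ T, EqOn β βR (Ico t₀ T) := fun T t ht => hβR t ht.1
    rcases hR with h | ⟨ω, hω, hc, hs, hend⟩
    · left
      intro T hT
      obtain ⟨hc, hs⟩ := h T hT
      exact ⟨hc.congr (hE T), fun t ht => by rw [hE T ht]; exact hs t ht⟩
    · right
      refine ⟨ω, hω, hc.congr (hE ω), fun t ht => by rw [hE ω ht]; exact hs t ht, ?_⟩
      have hev : β =ᶠ[𝓝[<] ω] βR :=
        mem_of_superset (Ioo_mem_nhdsLT hω) fun u hu => hβR u hu.1.le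
      rcases hend with h0 | htop
      · exact Or.inl (h0.congr' (hev.mono fun u hu => hu.symm))
      · exact Or.inr (htop.congr' (hev.mono fun u hu => hu.symm))

end OsculationPeel

end Summit.ValiantsHypothesis.ValiantsHypothesis.Theorems.LacunarySymmetroidMatrixDescartes

end
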